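/-
HONEST FRAMING: certified error envelopes and provably optimal rounding/accumulation schemes for
low-precision formats under stated cost models; every table by two implementations; no hardware
or vendor claims.
-/
import Summits.Ventures.CertifiedArithmetic.LowPrec.OptDemotionAllLines
import Summits.Ventures.CertifiedArithmetic.LowPrec.OptDemotionEveryTree

/-!
# The demotion law (Theorem T8), part 6b: the ROOT STEP for every tree (OPTIMA (iii″)(R8))

Conjecture D (OPTIMA.md §B T8(b)(iii)): a summation tree `t` of nonnegative `F_q` data evaluated in
the wide format and demoted ONCE to `F_p` satisfies `s ≤ Q_t · fl_p(ŝ)`, `Q_t = treeQf u_q t u_p`.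
Part 5f proved it for `M_t(u_q) ≤ 2` from a line invariant at the root plus a demotion step whose
proof used the goodness (`λ ≤ α`) of the root's active line.

THIS FILE is opt's (R8): the demotion step needs NO hypothesis on the tree and NO goodness — only
that the root's deficit is bounded by SOME line of the full family `L_t` (`allLines`, part 6a):

* `root_step_of_line` — numbers only: if `s ≤ v + σ(α - λ) + λv` with `0 ≤ λ`,
  `1 + λ ≤ Q`, `1 + P + α + λP ≤ Q`, and `r` is any number with `σ ≤ r` and `v - Pσ ≤ r`, then
  `s ≤ Q·r`.  (Below the first midpoint the line is read at `x ≤ P`; above it the slope `1 + λ ≤ Q`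
  pays for the excess — the two inequalities of (R8).)
* `exact_le_treeQf_mul_fl_of_rootLine` — THE ROOT STEP IN `F(q,emin) → F(p,emin)`: for EVERY tree,
  all `p, q ≥ 1`, any nearest roundings: if the computed root `ŝ > 0` carries a line
  `(α, λ) ∈ L_t` with `s - ŝ ≤ ufp(ŝ)(α - λ) + λŝ`, then `s ≤ Q_t · fl_p(ŝ)` (gradual underflow of
  `F_p` included: below `2^(emin+p)` the demotion is exact).
* `exact_le_treeQf_mul_fl_of_invariant` — packaged with the zero case.
So `M_t(u_q) ≤ 2` survives ONLY inside the node step (part 5e); parts 6c–6d replace that node step.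
-/

namespace Summit.Ventures.CertifiedArithmetic.LowPrec.Opt

open Literature.ComputerArithmetic.JeannerodRump2018
open Literature.ComputerArithmetic.JeannerodRump2018.SumTree

/-! ## The arithmetic of the demotion step -/

/-- THE TWO INEQUALITIES OF (R8), numbers only: the line bound `s ≤ v + σ(α - λ) + λ v` with
`0 ≤ λ`, `1 + λ ≤ Q` (slope) and `1 + P + α + λP ≤ Q` (the line read at `P`), `σ ≥ 0`, and a demoted
value `r ≥ σ`, `r ≥ v - Pσ`: then `s ≤ Q·r`. -/
theorem root_step_of_line {s v σ α lam P Q r : ℚ} (hσ : 0 ≤ σ) (hlam : 0 ≤ lam) (hs : s ≤ v + σ * (α - lam) + lam * v)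
    (hslope : 1 + lam ≤ Q) (hline : 1 + P + α + lam * P ≤ Q)
    (hrσ : σ ≤ r) (hrv : v - P * σ ≤ r) : s ≤ Q * r := by
  have hQ0 : 0 ≤ Q := by linarith
  rcases le_or_gt v (σ + P * σ) with hA | hB
  · -- below the first midpoint: read the line at excess ≤ P, and r ≥ σ
    have h1 : s ≤ (1 + P + α + lam * P) * σ := by
      have : (1 + lam) * v ≤ (1 + lam) * (σ + P * σ) :=
        mul_le_mul_of_nonneg_left hA (by linarith)
      nlinarith
    calc s ≤ (1 + P + α + lam * P) * σ := h1
      _ ≤ Q * σ := mul_le_mul_of_nonneg_right hline hσ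
      _ ≤ Q * r := mul_le_mul_of_nonneg_left hrσ hQ0
  · -- above it: s ≤ Qσ + (1+λ)(v - σ - Pσ) ≤ Q (v - Pσ) ≤ Q r
    have hgap : 0 ≤ v - σ - P * σ := by linarith
    have h1 : s ≤ Q * σ + (1 + lam) * (v - σ - P * σ) := by nlinarith
    have h2 : (1 + lam) * (v - σ - P * σ) ≤ Q * (v - σ - P * σ) :=
      mul_le_mul_of_nonneg_right hslope hgap
    calc s ≤ Q * σ + Q * (v - σ - P * σ) := by linarith
      _ = Q * (v - P * σ) := by ring
      _ ≤ Q * r := mul_le_mul_of_nonneg_left hrv hQ0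

/-! ## The root step in `F(q, emin) → F(p, emin)` -/

section Root

variable {q : ℕ} {emin : ℤ} {fl : ℚ → ℚ}

/-- **THE ROOT STEP FOR EVERY TREE (R8).**  `p, q ≥ 1`, any nearest roundings `fl_q` into
`F(q, emin)` and `fl_p` into `F(p, emin)`, ANY tree `t` of nonnegative `F(q, emin)` data (no hypothesis
on `M_t`).  If the computed root `ŝ > 0` satisfies the line bound
`s - ŝ ≤ ufp(ŝ)·(α - λ) + λ·ŝ` for some `(α, λ)` of the FULL family `L_t` (goodness not required),
then `s ≤ Q_t · fl_p(ŝ)`. -/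
theorem exact_le_treeQf_mul_fl_of_rootLine {p : ℕ} (hp : 1 ≤ p) {flp : ℚ → ℚ}
    (hfl : IsRoundNearest q emin fl) (hflp : IsRoundNearest p emin flp) (t : SumTree)
    (ht : ∀ x ∈ leaves t, IsFloat q emin x ∧ 0 ≤ x) (hpos : 0 < eval fl t)
    {l : ℚ × ℚ} (hl : l ∈ allLines (unitRoundoff q) t)
    (hdef : exact t - eval fl t ≤ (2 : ℚ) ^ (Int.log 2 (eval fl t)) * (l.1 - l.2) + l.2 * eval fl t) :
    exact t ≤ treeQf (unitRoundoff q) t (unitRoundoff p) * flp (eval fl t) := by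
  set u := unitRoundoff q with hu
  set P := unitRoundoff p with hP
  have hu0 : 0 ≤ u := unitRoundoff_nonneg q
  have hu1 : u ≤ 1 := unitRoundoff_le_one q
  have hupos : 0 < u := by rw [hu]; unfold unitRoundoff; positivity
  have hP0 : 0 < P := by rw [hP]; unfold unitRoundoff; positivity
  obtain ⟨hvF, hv0⟩ := eval_isFloat_nonneg hfl t ht
  set v := eval fl t with hv
  obtain ⟨hL0, hLM, -, -⟩ := allLines_bounds hu0 hu1 t l hl
  -- the line read at P, and the slope
  have hline : 1 + P + l.1 + l.2 * P ≤ treeQf u t P := allLine_le_treeQf hupos t l hl P hP0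
  have hslope : 1 + l.2 ≤ treeQf u t P := by
    have hμ := allLine_le_treeQf hupos t _ (mu_mem_allLines hu0 hu1 t) P hP0
    dsimp only at hμ; linarith
  set K := Int.log 2 v with hK
  have hvlo : ((2 : ℕ) : ℚ) ^ K ≤ v := Int.zpow_log_le_self (by norm_num) hpos
  have hvhi : v < ((2 : ℕ) : ℚ) ^ (K + 1) := Int.lt_zpow_succ_log_self (by norm_num) v
  push_cast at hvlo hvhi
  have hσpos : (0 : ℚ) < (2 : ℚ) ^ K := zpow_pos (by norm_num) _
  have hs : exact t ≤ v + (2 : ℚ) ^ K * (l.1 - l.2) + l.2 * v := by linarith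
  by_cases hsmall : v < (2 : ℚ) ^ (emin + p)
  · -- no demotion error: r = v
    have hr : flp v = v := fl_eq_self hflp (isFloat_narrow_of_small hvF hv0 hsmall)
    rw [hr]
    exact root_step_of_line hσpos.le hL0 hs hslope hline hvlo (by nlinarith)
  · -- demotion in the normal range of F_p: r ≥ σ and r ≥ v - u_p σ
    have hKe : emin + p ≤ K + 1 := by
      by_contra hlt
      have : (2 : ℚ) ^ (K + 1) ≤ (2 : ℚ) ^ (emin + (p : ℤ)) :=
        zpow_le_zpow_right₀ (by norm_num) (by omega)
      linarith
    have herr := abs_sub_fl_le_half_ulp hp hflp hvlo hvhi hKe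
    have hrσ : (2 : ℚ) ^ K ≤ flp v :=
      le_fl_of_isFloat_le hflp (PTree.isFloat_two_zpow hp (by omega)) hvlo
    have hrv : v - P * (2 : ℚ) ^ K ≤ flp v := by
      have := (abs_le.mp herr).2; rw [hP]; linarith
    exact root_step_of_line hσpos.le hL0 hs hslope hline hrσ hrv

/-- The root step packaged with the zero case: if the LINE INVARIANT holds at the root of `t` —
`ŝ = 0 ⇒ s ≤ 0`, and `ŝ > 0 ⇒` some line of `L_t` bounds the deficit — then `s ≤ Q_t · fl_p(ŝ)`,
for EVERY tree. -/
theorem exact_le_treeQf_mul_fl_of_invariant {p : ℕ} (hp : 1 ≤ p) {flp : ℚ → ℚ}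
    (hfl : IsRoundNearest q emin fl) (hflp : IsRoundNearest p emin flp) (t : SumTree)
    (ht : ∀ x ∈ leaves t, IsFloat q emin x ∧ 0 ≤ x)
    (hzero : eval fl t = 0 → exact t ≤ 0)
    (hline : 0 < eval fl t → ∃ l ∈ allLines (unitRoundoff q) t,
      exact t - eval fl t ≤ (2 : ℚ) ^ (Int.log 2 (eval fl t)) * (l.1 - l.2) + l.2 * eval fl t) :
    exact t ≤ treeQf (unitRoundoff q) t (unitRoundoff p) * flp (eval fl t) := by
  obtain ⟨_, hv0⟩ := eval_isFloat_nonneg hfl t ht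
  rcases eq_or_lt_of_le hv0 with h0 | hpos
  · rw [← h0, fl_eq_self hflp (isFloat_zero p emin), mul_zero]
    exact hzero h0.symm
  · obtain ⟨l, hl, hdef⟩ := hline hpos
    exact exact_le_treeQf_mul_fl_of_rootLine hp hfl hflp t ht hpos hl hdef

end Root

end Summit.Ventures.CertifiedArithmetic.LowPrec.Opt
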